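import Mathlib
import Literature.NumberTheory.Transcendental.GammaIsoCross
import Literature.NumberTheory.Transcendental.ZilberGenericClosedness
import Literature.NumberTheory.Transcendental.PseudoExpVariants
import Literature.NumberTheory.Transcendental.PseudoExpAmbient
import Literature.NumberTheory.Transcendental.GammaFieldsEcl
import Summits.Schanuel.Schanuel.Theorems.RigidCoreAclSubsetLogFreeCoreDoubleBaseAux3

/-!
# The double of a free extension inside `ℂ`: the field `K = ℚ(D ∪ θ D)` and the two copies
(auxiliary file 4 for the stub `stub_doubleBase` of line `eac-extends-core-automorphisms`,
crux stmt-Schanuel-0968)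

Continuing auxiliary files 2–3 (same local notations; no new definitions). For a subfield
`K ≤ ℂ` containing `D_ℂ = 𝕎 + ℚe'` and `θ(D_ℂ)` and generated by them (hypotheses `hDK`, `hθK`,
`hKle`; in the stub `K = ℚ(D_ℂ ∪ θ D_ℂ)`): `𝔽 ≤ K` and `φ(𝔽) ≤ K` (`coe_mem_K`, `phi_mem_K`),
so the two copies `j₁ = incl`, `j₂ = φ : 𝔽 → K` exist (`exists_ringHom_coe_eq`), as do the
`ℚ`-linear inclusion `K → ℂ` (`exists_linearMap_coe_eq`) and `θ` as a self-map of `K`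
(`exists_thetaK`); the domain `D = span (j₁ 𝕎 ∪ j₂ 𝕎) ≤ K` corresponds to `D_ℂ` under `K ≤ ℂ`
(`map_DK_eq`, `mem_DK_iff`); and **`(K, D, θ, t)` is a finitely generated partial exponential
field with standard kernel** (`isStdKernelPartialExpField`;
`Literature.NumberTheory.Transcendental.IsStdKernelPartialExpField`, Bays–Kirby 2018 §9.2,
after the template `Literature.Barriers.Schanuel.exists_isStdKernelPartialExpField`).
-/

noncomputable section

set_option linter.dupNamespace false

open Set
open scoped Matroid
open Literature.ModelTheory.ExponentialFields Literature.ModelTheory.ExponentialFields.ExponentialRing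
open Literature.NumberTheory.Transcendental Literature.NumberTheory.Transcendental.GammaField

namespace Summit.Schanuel.Schanuel.Theorems.RigidCore

namespace DoubleBase

variable {τ : ℂ} {N k : ℕ} {c : Fin N → ℂ} {e : Fin k → ℂ}

set_option quotPrecheck false in
/-- `𝕏 = ℚτ + ℚc` (local notation only). -/
local notation "𝕏" =>
  (Submodule.span ℚ ({τ} : Set ℂ) ⊔ Submodule.span ℚ (Set.range c) : Submodule ℚ ℂ)

set_option quotPrecheck false in
/-- `𝕎 = ℚτ + ℚ(c, e) = 𝕏 + ℚe` (local notation only). -/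
local notation "𝕎" => (Submodule.span ℚ ({τ} : Set ℂ) ⊔
  Submodule.span ℚ (Set.range (Fin.append c e)) : Submodule ℚ ℂ)

set_option quotPrecheck false in
/-- `𝔽 = ℚ(𝕎 ∪ exp 𝕎)`, the Γ-field of `𝕎` (local notation only). -/
local notation "𝔽" => (fieldOf (F := ℂ)
  (Submodule.span ℚ ({τ} : Set ℂ) ⊔ Submodule.span ℚ (Set.range (Fin.append c e))))

set_option quotPrecheck false in
/-- Freeness of `e` over `𝕏` (local notation only). -/
local notation "FreeH" => (∀ m : Fin k → ℤ, m ≠ 0 →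
  (∑ j, (m j : ℚ) • e j) ∉ acl (gens 𝕏) ∧ Complex.exp (∑ j, (m j : ℚ) • e j) ∉ acl (gens 𝕏))

set_option quotPrecheck false in
/-- `φ` is the identity on `ℚ(gens 𝕏)` (local notation only). -/
local notation "FixH[" φ "]" => (∀ (x : ℂ) (hx : x ∈ 𝔽), x ∈ fieldOf 𝕏 → φ ⟨x, hx⟩ = x)

set_option quotPrecheck false in
/-- `φ(𝔽)` is algebraically disjoint from `𝔽` over `ℚ(gens 𝕏)` (local notation only). -/
local notation "RelH[" φ "]" => (∀ S : Set 𝔽,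
  (algMatroid ℂ).relRank ((𝔽 : IntermediateField ℚ ℂ) : Set ℂ) (φ '' S) =
    (algMatroid ℂ).relRank (fieldOf 𝕏 : Set ℂ) (φ '' S))

set_option quotPrecheck false in
/-- `e' = φ ∘ e` (local notation only). -/
local notation "EpH[" φ "," e' "]" => (∀ (j : Fin k) (h : e j ∈ 𝔽), φ ⟨e j, h⟩ = e' j)

set_option quotPrecheck false in
/-- The characterising property of the partial exponential `θ` (local notation only). -/
local notation "ThH[" φ "," e' "," θ "]" => (∀ w ∈ 𝕎, ∀ (q : Fin k → ℚ)
  (h : Complex.exp (∑ j, q j • e j) ∈ 𝔽),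
  θ (w + ∑ j, q j • e' j) = Complex.exp w * φ ⟨Complex.exp (∑ j, q j • e j), h⟩)

set_option quotPrecheck false in
/-- `𝔻[e'] = 𝕎 + ℚe'`, the domain `D_ℂ` inside `ℂ` (local notation only). -/
local notation "𝔻[" e' "]" => ((Submodule.span ℚ ({τ} : Set ℂ) ⊔
  Submodule.span ℚ (Set.range (Fin.append c e))) ⊔ Submodule.span ℚ (Set.range e') : Submodule ℚ ℂ)

set_option quotPrecheck false in
/-- `𝔻K[j₁, j₂] = span (j₁ 𝕎 ∪ j₂ 𝕎)`, the domain `D ≤ K`, literally as in the stub (local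
notation only). -/
local notation "𝔻K[" j₁ "," j₂ "]" => (Submodule.span ℚ
  ((fun x : 𝔽 => j₁ x) '' {x : 𝔽 | (x : ℂ) ∈ Submodule.span ℚ ({τ} : Set ℂ) ⊔
      Submodule.span ℚ (Set.range (Fin.append c e))} ∪
    (fun x : 𝔽 => j₂ x) '' {x : 𝔽 | (x : ℂ) ∈ Submodule.span ℚ ({τ} : Set ℂ) ⊔
      Submodule.span ℚ (Set.range (Fin.append c e))}))

/-! ### Data on a subfield `K ≤ ℂ`: the inclusion, ring homomorphisms into `K`, `θ` on `K` -/

/-- The inclusion of a subfield `K ≤ ℂ` as a `ℚ`-linear map. -/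
theorem exists_linearMap_coe_eq (K : Subfield ℂ) : ∃ v : K →ₗ[ℚ] ℂ, ∀ x, v x = x :=
  ⟨{ toFun := Subtype.val
     map_add' := fun _ _ => rfl
     map_smul' := fun a x => by
       change ((a • x : K) : ℂ) = a • (x : ℂ)
       rw [Rat.smul_def, Rat.smul_def, Subfield.coe_mul, SubfieldClass.coe_ratCast] },
    fun _ => rfl⟩

/-- A ring homomorphism `𝔽 → ℂ` with values in `K` corestricts to `𝔽 →+* K`. -/
theorem exists_ringHom_coe_eq (K : Subfield ℂ) (f : 𝔽 →+* ℂ) (h : ∀ x, f x ∈ K) :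
    ∃ j : 𝔽 →+* K, ∀ x, (j x : ℂ) = f x :=
  ⟨f.codRestrict K h, fun _ => rfl⟩

/-- `θ` as a self-map of `K` (on elements of `D_ℂ`; `1` elsewhere). -/
theorem exists_thetaK (K : Subfield ℂ) {e' : Fin k → ℂ} {θ : ℂ → ℂ}
    (hθK : ∀ z ∈ 𝔻[e'], θ z ∈ K) :
    ∃ θK : K → K, ∀ z : K, (z : ℂ) ∈ 𝔻[e'] → (θK z : ℂ) = θ z := by
  classical
  refine ⟨fun z => if hz : (z : ℂ) ∈ 𝔻[e'] then ⟨θ z, hθK z hz⟩ else 1, fun z hz => ?_⟩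
  dsimp only
  rw [dif_pos hz]

/-! ### `𝔽 ≤ K` and `φ(𝔽) ≤ K` -/

/-- **`𝔽 ≤ K`**: `K` contains `𝕎 ⊆ D_ℂ` and `exp 𝕎 = θ(𝕎)`. -/
theorem coe_mem_K {φ : 𝔽 →+* ℂ} {e' : Fin k → ℂ} {θ : ℂ → ℂ} (hθ : ThH[φ, e', θ])
    {K : Subfield ℂ} (hDK : ∀ z ∈ 𝔻[e'], z ∈ K) (hθK : ∀ z ∈ 𝔻[e'], θ z ∈ K) (x : 𝔽) :
    (x : ℂ) ∈ K := by
  have hK : ∀ q : ℚ, algebraMap ℚ ℂ q ∈ K := fun q => by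
    rw [show algebraMap ℚ ℂ q = (q : ℂ) from rfl]
    exact SubfieldClass.ratCast_mem K q
  have hle : 𝔽 ≤ K.toIntermediateField hK := by
    change IntermediateField.adjoin ℚ (gens 𝕎) ≤ _
    rw [IntermediateField.adjoin_le_iff]
    rintro z (hz | ⟨w, hw, rfl⟩)
    · exact hDK z (Submodule.mem_sup_left hz)
    · change Complex.exp w ∈ K
      rw [← theta_of_mem_W hθ hw]
      exact hθK w (Submodule.mem_sup_left hw)
  exact hle x.2

/-- **`φ(𝔽) ≤ K`**: `K` contains `φ(𝕎) ⊆ D_ℂ` and `φ(exp 𝕎) = θ(φ 𝕎)`. -/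
theorem phi_mem_K {φ : 𝔽 →+* ℂ} {e' : Fin k → ℂ} {θ : ℂ → ℂ} (hθ : ThH[φ, e', θ])
    (he' : EpH[φ, e']) (hfix : FixH[φ]) {K : Subfield ℂ} (hDK : ∀ z ∈ 𝔻[e'], z ∈ K)
    (hθK : ∀ z ∈ 𝔻[e'], θ z ∈ K) (x : 𝔽) : φ x ∈ K := by
  obtain ⟨x, hx⟩ := x
  have hx' : x ∈ IntermediateField.adjoin ℚ (gens 𝕎) := hx
  refine IntermediateField.adjoin_induction ℚ (p := fun y hy => φ ⟨y, hy⟩ ∈ K) ?_ ?_ ?_ ?_ ?_ hx'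
  · rintro y (hy | ⟨w, hw, rfl⟩)
    · exact hDK _ (phi_mem_Dc he' hfix hy _)
    · change φ ⟨Complex.exp w, _⟩ ∈ K
      rw [← theta_phi hθ he' hfix hw (mem_Fd_of_mem hw)]
      exact hθK _ (phi_mem_Dc he' hfix hw _)
  · intro q
    have : φ ⟨algebraMap ℚ ℂ q, IntermediateField.algebraMap_mem _ q⟩ = (q : ℂ) := by
      rw [show (⟨algebraMap ℚ ℂ q, IntermediateField.algebraMap_mem _ q⟩ : 𝔽) = ((q : ℚ) : 𝔽) from
        Subtype.ext rfl, map_ratCast]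
    rw [this]
    exact SubfieldClass.ratCast_mem K q
  · intro y z hy hz hy' hz'
    exact (map_add φ ⟨y, hy⟩ ⟨z, hz⟩) ▸ K.add_mem hy' hz'
  · intro y hy hy'
    exact (map_inv₀ φ ⟨y, hy⟩) ▸ K.inv_mem hy'
  · intro y z hy hz hy' hz'
    exact (map_mul φ ⟨y, hy⟩ ⟨z, hz⟩) ▸ K.mul_mem hy' hz'

/-! ### The domain `D ≤ K` corresponds to `D_ℂ` -/

/-- The image of `D = span (j₁ 𝕎 ∪ j₂ 𝕎)` in `ℂ` is `D_ℂ = 𝕎 + ℚe'`. -/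
theorem map_DK_eq {φ : 𝔽 →+* ℂ} {e' : Fin k → ℂ} (he' : EpH[φ, e']) (hfix : FixH[φ])
    {K : Subfield ℂ} {j₁ j₂ : 𝔽 →+* K} (hj₁ : ∀ x, (j₁ x : ℂ) = x) (hj₂ : ∀ x, (j₂ x : ℂ) = φ x)
    {v : K →ₗ[ℚ] ℂ} (hv : ∀ x, v x = x) : (𝔻K[j₁, j₂]).map v = 𝔻[e'] := by
  rw [Submodule.map_span, image_union, ← image_comp, ← image_comp, Submodule.span_union]
  have h1 : (v ∘ fun x : 𝔽 => j₁ x) '' {x : 𝔽 | (x : ℂ) ∈ 𝕎} = ((𝕎 : Submodule ℚ ℂ) : Set ℂ) := by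
    ext z
    constructor
    · rintro ⟨x, hx, rfl⟩
      change v (j₁ x) ∈ 𝕎
      rw [hv, hj₁]; exact hx
    · intro hz
      refine ⟨⟨z, mem_Fd_of_mem hz⟩, hz, ?_⟩
      change v (j₁ _) = z
      rw [hv, hj₁]
  have h2 : Submodule.span ℚ ((v ∘ fun x : 𝔽 => j₂ x) '' {x : 𝔽 | (x : ℂ) ∈ 𝕎}) =
      𝕏 ⊔ Submodule.span ℚ (range e') := by
    apply le_antisymm
    · rw [Submodule.span_le]
      rintro _ ⟨x, hx, rfl⟩
      obtain ⟨y, hy, q, hyq⟩ := mem_Wsp_iff.1 hx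
      change v (j₂ x) ∈ 𝕏 ⊔ Submodule.span ℚ (range e')
      rw [hv, hj₂, show x = ⟨y + ∑ j, q j • e j, hyq ▸ x.2⟩ from Subtype.ext hyq,
        phi_of_mem_W he' hfix hy q]
      exact Submodule.add_mem _ (Submodule.mem_sup_left hy)
        (Submodule.mem_sup_right (Submodule.sum_mem _ fun j _ =>
          Submodule.smul_mem _ _ (Submodule.subset_span ⟨j, rfl⟩)))
    · refine sup_le ?_ ?_
      · intro y hy
        refine Submodule.subset_span ⟨⟨y, mem_Fd_of_mem (Xsp_le_Wsp e hy)⟩, Xsp_le_Wsp e hy, ?_⟩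
        change v (j₂ _) = y
        rw [hv, hj₂]
        exact hfix y _ (mem_F₀_of_mem hy)
      · rw [Submodule.span_le]
        rintro _ ⟨j, rfl⟩
        refine Submodule.subset_span ⟨⟨e j, mem_Fd_of_mem (e_mem_Wsp τ c e j)⟩, e_mem_Wsp τ c e j, ?_⟩
        change v (j₂ _) = e' j
        rw [hv, hj₂, he']
  rw [h1, h2, Submodule.span_eq, ← sup_assoc, sup_of_le_left (Xsp_le_Wsp e)]

/-- **Membership in `D` is membership in `D_ℂ`.** -/
theorem mem_DK_iff {φ : 𝔽 →+* ℂ} {e' : Fin k → ℂ} (he' : EpH[φ, e']) (hfix : FixH[φ])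
    {K : Subfield ℂ} {j₁ j₂ : 𝔽 →+* K} (hj₁ : ∀ x, (j₁ x : ℂ) = x) (hj₂ : ∀ x, (j₂ x : ℂ) = φ x)
    {v : K →ₗ[ℚ] ℂ} (hv : ∀ x, v x = x) (z : K) : z ∈ 𝔻K[j₁, j₂] ↔ (z : ℂ) ∈ 𝔻[e'] := by
  rw [← map_DK_eq he' hfix hj₁ hj₂ hv, ← hv z]
  constructor
  · intro hz
    exact Submodule.mem_map_of_mem hz
  · intro hz
    obtain ⟨y, hy, hyz⟩ := Submodule.mem_map.1 hz
    have hinj : y = z := Subtype.ext (by rw [← hv y, ← hv z]; exact hyz)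
    rwa [← hinj]

/-! ### The standard-kernel partial exponential field `(K, D, θ, t)` -/

/-- **`(K, D, θ, t)` is a finitely generated partial exponential field with standard kernel**
(Bays–Kirby 2018 §9.2; `IsStdKernelPartialExpField`): `D ≅ D_ℂ` is finite-dimensional, `θ` is
a homomorphism into `Kˣ` on `D` with kernel `tℤ` (`theta_add`, `theta_eq_one_iff`), `t = 2πi`
is transcendental (Lindemann), and `K` is generated by `D ∪ θ(D)` (`hKle`). -/
theorem isStdKernelPartialExpField {φ : 𝔽 →+* ℂ} {e' : Fin k → ℂ} {θ : ℂ → ℂ}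
    (hθ : ThH[φ, e', θ]) (he' : EpH[φ, e']) (hlin : LinIndepOver 𝕏 e) (hfree : FreeH)
    (hfix : FixH[φ]) (hrel : RelH[φ]) (hτ : τ = 2 * ↑Real.pi * Complex.I)
    {K : Subfield ℂ} (hDK : ∀ z ∈ 𝔻[e'], z ∈ K)
    (hKle : K ≤ Subfield.closure
      (((𝔻[e'] : Submodule ℚ ℂ) : Set ℂ) ∪ θ '' ((𝔻[e'] : Submodule ℚ ℂ) : Set ℂ)))
    {j₁ j₂ : 𝔽 →+* K} (hj₁ : ∀ x, (j₁ x : ℂ) = x) (hj₂ : ∀ x, (j₂ x : ℂ) = φ x)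
    {v : K →ₗ[ℚ] ℂ} (hv : ∀ x, v x = x)
    {θK : K → K} (hθK : ∀ z : K, (z : ℂ) ∈ 𝔻[e'] → (θK z : ℂ) = θ z)
    {t : K} (ht : (t : ℂ) = τ) :
    IsStdKernelPartialExpField K 𝔻K[j₁, j₂] θK t := by
  classical
  have hmemD := mem_DK_iff he' hfix hj₁ hj₂ hv
  have hvinj : Function.Injective v := fun x y hxy => Subtype.ext (by rw [← hv x, ← hv y]; exact hxy)
  have hcoe_zsmul : ∀ (n : ℤ) (x : K), ((n • x : K) : ℂ) = n • (x : ℂ) :=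
    fun n x => map_zsmul K.subtype n x
  refine
    { finiteDimensional := ?_
      map_add := ?_
      map_ne_zero := ?_
      mem := (hmemD _).2 (by rw [ht]; exact Submodule.mem_sup_left (Xsp_le_Wsp e (tau_mem_Xsp τ c)))
      transcendental := ?_
      map_eq_one_iff := ?_
      closure_eq_top := ?_ }
  · -- `D ≅ D_ℂ = span (finite set)`
    have hDc : Module.Finite ℚ (𝔻[e'] : Submodule ℚ ℂ) := by
      rw [← Submodule.span_union, ← Submodule.span_union]
      exact Module.Finite.span_of_finite ℚ
        (((finite_singleton τ).union (finite_range _)).union (finite_range _))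
    have e₁ := Submodule.equivMapOfInjective v hvinj 𝔻K[j₁, j₂]
    rw [map_DK_eq he' hfix hj₁ hj₂ hv] at e₁
    exact Module.Finite.equiv e₁.symm
  · intro x y hx hy
    rw [hmemD] at hx hy
    have hxy : ((x + y : K) : ℂ) ∈ 𝔻[e'] := Submodule.add_mem _ hx hy
    apply Subtype.ext
    rw [Subfield.coe_mul, hθK _ hxy, hθK _ hx, hθK _ hy, Subfield.coe_add]
    exact theta_add hθ hx hy
  · intro x hx
    rw [hmemD] at hx
    rw [Ne, Subtype.ext_iff, hθK _ hx]
    exact theta_ne_zero hθ hx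
  · intro halg
    have h := halg.algHom K.subtype.toRatAlgHom
    change IsAlgebraic ℚ (t : ℂ) at h
    rw [ht, hτ] at h
    exact PseudoExpAmbient.transcendental_twoPiI h
  · intro x hx
    rw [hmemD] at hx
    rw [Subtype.ext_iff, hθK _ hx, Subfield.coe_one, theta_eq_one_iff hθ hlin hfree hfix hrel hτ hx,
      AddSubgroup.mem_zmultiples_iff]
    constructor
    · rintro ⟨n, hn⟩
      exact ⟨n, Subtype.ext (by rw [hcoe_zsmul, ht]; exact hn.symm)⟩
    · rintro ⟨n, rfl⟩
      exact ⟨n, by rw [hcoe_zsmul, ht]⟩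
  · -- `K` is generated by `D ∪ θ(D)`: push the closure in `K` forward to `ℂ`
    rw [eq_top_iff]
    intro x _
    set S : Subfield K := Subfield.closure ((𝔻K[j₁, j₂] : Set K) ∪ θK '' 𝔻K[j₁, j₂]) with hS
    have hle : K ≤ S.map K.subtype := by
      refine hKle.trans (Subfield.closure_le.mpr ?_)
      rintro z (hz | ⟨d, hd, rfl⟩)
      · exact ⟨⟨z, hDK z hz⟩, Subfield.subset_closure (Or.inl ((hmemD _).2 hz)), rfl⟩
      · refine ⟨θK ⟨d, hDK d hd⟩,
          Subfield.subset_closure (Or.inr ⟨⟨d, hDK d hd⟩, (hmemD _).2 hd, rfl⟩), ?_⟩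
        exact hθK ⟨d, hDK d hd⟩ hd
    obtain ⟨y, hy, hyx⟩ := hle x.2
    rwa [← Subtype.val_injective hyx]

/-! ### The conjuncts about the two copies -/

/-- **Both copies send `τ ↦ t`.** -/
theorem j_tau {φ : 𝔽 →+* ℂ} (hfix : FixH[φ]) {K : Subfield ℂ} {j₁ j₂ : 𝔽 →+* K}
    (hj₁ : ∀ x, (j₁ x : ℂ) = x) (hj₂ : ∀ x, (j₂ x : ℂ) = φ x) {t : K} (ht : (t : ℂ) = τ)
    (hτF : τ ∈ 𝔽) : j₁ ⟨τ, hτF⟩ = t ∧ j₂ ⟨τ, hτF⟩ = t :=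
  ⟨Subtype.ext ((hj₁ _).trans ht.symm),
    Subtype.ext ((hj₂ _).trans ((hfix τ hτF (mem_F₀_of_mem (tau_mem_Xsp τ c))).trans ht.symm))⟩

/-- **The two copies agree on the generators of the Γ-field of `𝕏`** (all Kummer levels). -/
theorem j_agree {φ : 𝔽 →+* ℂ} (hfix : FixH[φ]) {K : Subfield ℂ} {j₁ j₂ : 𝔽 →+* K}
    (hj₁ : ∀ x, (j₁ x : ℂ) = x) (hj₂ : ∀ x, (j₂ x : ℂ) = φ x) (x : ℂ) (hxF : x ∈ 𝔽)
    (h : x ∈ 𝕏 ∨ ∃ y ∈ 𝕏, ∃ M : ℕ, x = Complex.exp (y / (M.factorial : ℂ))) :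
    j₁ ⟨x, hxF⟩ = j₂ ⟨x, hxF⟩ := by
  apply Subtype.ext
  rw [hj₁, hj₂]
  refine (hfix x hxF ?_).symm
  rcases h with hx | ⟨y, hy, M, rfl⟩
  · exact mem_F₀_of_mem hx
  · exact exp_div_mem_F₀ hy M

/-- **`θ` extends `exp` along both copies.** -/
theorem theta_j {φ : 𝔽 →+* ℂ} {e' : Fin k → ℂ} {θ : ℂ → ℂ} (hθ : ThH[φ, e', θ])
    (he' : EpH[φ, e']) (hfix : FixH[φ]) {K : Subfield ℂ} {j₁ j₂ : 𝔽 →+* K}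
    (hj₁ : ∀ x, (j₁ x : ℂ) = x) (hj₂ : ∀ x, (j₂ x : ℂ) = φ x)
    {θK : K → K} (hθK : ∀ z : K, (z : ℂ) ∈ 𝔻[e'] → (θK z : ℂ) = θ z)
    (x : ℂ) (hxF : x ∈ 𝔽) (hexF : Complex.exp x ∈ 𝔽) (hxW : x ∈ 𝕎) :
    θK (j₁ ⟨x, hxF⟩) = j₁ ⟨Complex.exp x, hexF⟩ ∧
      θK (j₂ ⟨x, hxF⟩) = j₂ ⟨Complex.exp x, hexF⟩ := by
  constructor
  · apply Subtype.ext
    have h1 : ((j₁ ⟨x, hxF⟩ : K) : ℂ) ∈ 𝔻[e'] := by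
      rw [hj₁]; exact Submodule.mem_sup_left hxW
    rw [hθK _ h1, hj₁, hj₁]
    exact theta_of_mem_W hθ hxW
  · apply Subtype.ext
    have h2 : ((j₂ ⟨x, hxF⟩ : K) : ℂ) ∈ 𝔻[e'] := by
      rw [hj₂]; exact phi_mem_Dc he' hfix hxW hxF
    rw [hθK _ h2, hj₂, hj₂]
    exact theta_phi hθ he' hfix hxW hxF

end DoubleBase


/-- **Registered sub-goal of `stub_doubleBase` (auxiliary file 4): `(K, D, θ, t)` is a finitely
generated partial exponential field with standard kernel** —
`DoubleBase.isStdKernelPartialExpField` restated without local notations. -/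
theorem doubleBase_isStdKernelPartialExpField (τ : ℂ) {N k : ℕ} (c : Fin N → ℂ) (e : Fin k → ℂ)
    (φ : fieldOf (Submodule.span ℚ ({τ} : Set ℂ) ⊔ Submodule.span ℚ (range (Fin.append c e))) →+* ℂ)
    (e' : Fin k → ℂ)
    (he' : ∀ (j : Fin k) (h : e j ∈ fieldOf (Submodule.span ℚ ({τ} : Set ℂ) ⊔ Submodule.span ℚ (range (Fin.append c e)))),
      φ ⟨e j, h⟩ = e' j)
    (hlin : LinIndepOver (Submodule.span ℚ ({τ} : Set ℂ) ⊔ Submodule.span ℚ (range c)) e)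
    (hfree : ∀ m : Fin k → ℤ, m ≠ 0 →
      (∑ j, (m j : ℚ) • e j) ∉ acl (gens (Submodule.span ℚ ({τ} : Set ℂ) ⊔ Submodule.span ℚ (range c))) ∧
      Complex.exp (∑ j, (m j : ℚ) • e j) ∉ acl (gens (Submodule.span ℚ ({τ} : Set ℂ) ⊔ Submodule.span ℚ (range c))))
    (hfix : ∀ (x : ℂ) (hx : x ∈ fieldOf (Submodule.span ℚ ({τ} : Set ℂ) ⊔ Submodule.span ℚ (range (Fin.append c e)))),
      x ∈ fieldOf (Submodule.span ℚ ({τ} : Set ℂ) ⊔ Submodule.span ℚ (range c)) → φ ⟨x, hx⟩ = x)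
    (hrel : ∀ S : Set (fieldOf (Submodule.span ℚ ({τ} : Set ℂ) ⊔ Submodule.span ℚ (range (Fin.append c e)))),
      (algMatroid ℂ).relRank ((fieldOf (Submodule.span ℚ ({τ} : Set ℂ) ⊔ Submodule.span ℚ (range (Fin.append c e))) :
        IntermediateField ℚ ℂ) : Set ℂ) (φ '' S) =
      (algMatroid ℂ).relRank (fieldOf (Submodule.span ℚ ({τ} : Set ℂ) ⊔ Submodule.span ℚ (range c)) : Set ℂ) (φ '' S))
    (θ : ℂ → ℂ)
    (hθ : ∀ w ∈ Submodule.span ℚ ({τ} : Set ℂ) ⊔ Submodule.span ℚ (range (Fin.append c e)), ∀ (q : Fin k → ℚ)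
      (h : Complex.exp (∑ j, q j • e j) ∈ fieldOf (Submodule.span ℚ ({τ} : Set ℂ) ⊔ Submodule.span ℚ (range (Fin.append c e)))),
      θ (w + ∑ j, q j • e' j) = Complex.exp w * φ ⟨Complex.exp (∑ j, q j • e j), h⟩)
    (hτ : τ = 2 * ↑Real.pi * Complex.I) (K : Subfield ℂ)
    (hDK : ∀ z ∈ (Submodule.span ℚ ({τ} : Set ℂ) ⊔ Submodule.span ℚ (range (Fin.append c e))) ⊔ Submodule.span ℚ (range e'), z ∈ K)
    (hKle : K ≤ Subfield.closure
      ((((Submodule.span ℚ ({τ} : Set ℂ) ⊔ Submodule.span ℚ (range (Fin.append c e))) ⊔ Submodule.span ℚ (range e') : Submodule ℚ ℂ) : Set ℂ) ∪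
        θ '' (((Submodule.span ℚ ({τ} : Set ℂ) ⊔ Submodule.span ℚ (range (Fin.append c e))) ⊔ Submodule.span ℚ (range e') : Submodule ℚ ℂ) : Set ℂ)))
    (j₁ j₂ : fieldOf (Submodule.span ℚ ({τ} : Set ℂ) ⊔ Submodule.span ℚ (range (Fin.append c e))) →+* K)
    (hj₁ : ∀ x, (j₁ x : ℂ) = x) (hj₂ : ∀ x, (j₂ x : ℂ) = φ x) (v : K →ₗ[ℚ] ℂ) (hv : ∀ x, v x = x)
    (θK : K → K) (hθK : ∀ z : K, (z : ℂ) ∈ (Submodule.span ℚ ({τ} : Set ℂ) ⊔ Submodule.span ℚ (range (Fin.append c e))) ⊔ Submodule.span ℚ (range e') → (θK z : ℂ) = θ z)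
    (t : K) (ht : (t : ℂ) = τ) :
    IsStdKernelPartialExpField K
      (Submodule.span ℚ
      ((fun x : fieldOf (Submodule.span ℚ ({τ} : Set ℂ) ⊔ Submodule.span ℚ (range (Fin.append c e))) => j₁ x) ''
          {x : fieldOf (Submodule.span ℚ ({τ} : Set ℂ) ⊔ Submodule.span ℚ (range (Fin.append c e))) | (x : ℂ) ∈ Submodule.span ℚ ({τ} : Set ℂ) ⊔ Submodule.span ℚ (range (Fin.append c e))} ∪
        (fun x : fieldOf (Submodule.span ℚ ({τ} : Set ℂ) ⊔ Submodule.span ℚ (range (Fin.append c e))) => j₂ x) ''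
          {x : fieldOf (Submodule.span ℚ ({τ} : Set ℂ) ⊔ Submodule.span ℚ (range (Fin.append c e))) | (x : ℂ) ∈ Submodule.span ℚ ({τ} : Set ℂ) ⊔ Submodule.span ℚ (range (Fin.append c e))}))
      θK t :=
  DoubleBase.isStdKernelPartialExpField hθ he' hlin hfree hfix hrel hτ hDK hKle hj₁ hj₂ hv hθK ht

end Summit.Schanuel.Schanuel.Theorems.RigidCore
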